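import Summits.AtomisticToContinuum.Crystallization.Theses.DisclinationRation
import Summits.AtomisticToContinuum.Crystallization.Theorems.HullExactificationCascadeHullGoodEverywhere
import HarnessLib

/-!
# Crux `AlphabetGoodHullElement` (stmt-AtomisticToContinuum-15798), line `birth` —
# stub `stub_alphabetCleanHullElement`

EXACTIFICATION no. 1 for the enlarged alphabet {fcc, hcp, decahedral axis}: if the
alphabet-defect fraction of a sequence `x N` of Lennard-Jones ground states in `ℝ³` tends to `0`,
some hull element `S ∋ 0` of `x` (two-way matching of translates `x (φ j) + τ j` with `S` on
every ball, eventually in `j`) is `δ`-separated and every `y ∈ S` is alphabet-good with local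
scale `dist(y, S ∖ {y}) ≤ R₀`.

This is `hullGoodEverywhere_proof` (route `HullExactificationCascade`, stmt-12089) re-run with a
third pattern and without its relative-denseness step.  The argument is written once for a
GENERIC goodness predicate `G` and a generic third `Finset` pattern `P` of unit vectors
(`agce_clean_generic`): clean centres by pigeonhole (`hb_exists_far_from`), diagonal radii
(`Filter.extraction_forall_of_eventually`), recentring, compactness of uniformly discrete sets
(`exists_subseq_forall_eventually_ballMatch`), and passage of goodness to the limit pattern by
pattern (`hge_patternGood_of_limit`) after a three-way pigeonhole (`agce_frequently_or₃`), the
scale bound coming from the bond radius `hge_exists_bond_radius`.  The alphabet-specific input is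
(a) the decahedral-axis set as a `Finset` of unit vectors (`agce_exists_decFinset`) and (b) the
repackaging of the route's inlined predicate as `PatternGood fcc ∨ PatternGood hcp ∨
PatternGood P` (`agce_good3_of_alphabet`, `agce_alphabet_of_good3`).
-/

noncomputable section

namespace Summit.AtomisticToContinuum.Crystallization.Theorems.AlphabetGoodHullElementBirth

open Literature.MathematicalPhysics.StatisticalMechanics Literature.Geometry.DiscreteGeometry
open Filter Topology Metric

/-! ## The decahedral-axis pattern as a `Finset` of unit vectors -/

/-- A ring point `!₂[√3/2·cos θ, √3/2·sin θ, σ]` with `σ = ±1/2` is a unit vector. [folklore] -/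
private theorem norm_ring_eq_one (θ σ : ℝ) (hσ : σ = 1 / 2 ∨ σ = -(1 / 2)) :
    ‖(!₂[Real.sqrt 3 / 2 * Real.cos θ, Real.sqrt 3 / 2 * Real.sin θ, σ] :
      EuclideanSpace ℝ (Fin 3))‖ = 1 := by
  have hσ2 : σ ^ 2 = 1 / 4 := by rcases hσ with rfl | rfl <;> norm_num
  have h3 : Real.sqrt 3 ^ 2 = 3 := Real.sq_sqrt (by norm_num)
  rw [EuclideanSpace.norm_eq, Real.sqrt_eq_one, Fin.sum_univ_three]
  simp only [Matrix.cons_val_zero, Matrix.cons_val_one, Matrix.cons_val_two,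
    Matrix.tail_cons, Matrix.head_cons, Real.norm_eq_abs, sq_abs]
  nlinarith [Real.cos_sq_add_sin_sq θ]

/-- The poles `!₂[0, 0, ±1]` are unit vectors. [folklore] -/
private theorem norm_pole_eq_one (s : ℝ) (hs : s = 1 ∨ s = -1) :
    ‖(!₂[(0 : ℝ), 0, s] : EuclideanSpace ℝ (Fin 3))‖ = 1 := by
  rw [EuclideanSpace.norm_eq, Real.sqrt_eq_one, Fin.sum_univ_three]
  simp only [Matrix.cons_val_zero, Matrix.cons_val_one, Matrix.cons_val_two,
    Matrix.tail_cons, Matrix.head_cons, Real.norm_eq_abs, sq_abs]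
  rcases hs with rfl | rfl <;> norm_num

/-- **The decahedral-axis pattern is a finite set of unit vectors.** The twelve-point set
`{±e₃} ∪ {(√3/2·cos(2πk/5), √3/2·sin(2πk/5), ±1/2)}` inlined in `AlphabetGoodHullElement` is the
coercion of a non-empty `Finset` of unit vectors. [folklore] -/
theorem agce_exists_decFinset :
    ∃ P : Finset (EuclideanSpace ℝ (Fin 3)),
      (↑P : Set (EuclideanSpace ℝ (Fin 3))) = {p : EuclideanSpace ℝ (Fin 3) | p = !₂[(0 : ℝ), 0, 1] ∨ p = !₂[(0 : ℝ), 0, -1] ∨ ∃ k : Fin 5, ∃ σ : ℝ, (σ = 1 / 2 ∨ σ = -(1 / 2)) ∧ p = !₂[Real.sqrt 3 / 2 * Real.cos (2 * Real.pi * (k : ℝ) / 5), Real.sqrt 3 / 2 * Real.sin (2 * Real.pi * (k : ℝ) / 5), σ]} ∧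
      (∀ v ∈ P, ‖v‖ = 1) ∧ P.Nonempty := by
  set D : Set (EuclideanSpace ℝ (Fin 3)) := {p : EuclideanSpace ℝ (Fin 3) | p = !₂[(0 : ℝ), 0, 1] ∨ p = !₂[(0 : ℝ), 0, -1] ∨ ∃ k : Fin 5, ∃ σ : ℝ, (σ = 1 / 2 ∨ σ = -(1 / 2)) ∧ p = !₂[Real.sqrt 3 / 2 * Real.cos (2 * Real.pi * (k : ℝ) / 5), Real.sqrt 3 / 2 * Real.sin (2 * Real.pi * (k : ℝ) / 5), σ]} with hD
  have hsub : D ⊆ {!₂[(0 : ℝ), 0, 1], !₂[(0 : ℝ), 0, -1]} ∪ Set.range (fun kb : Fin 5 × Bool =>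
      (!₂[Real.sqrt 3 / 2 * Real.cos (2 * Real.pi * (kb.1 : ℝ) / 5),
        Real.sqrt 3 / 2 * Real.sin (2 * Real.pi * (kb.1 : ℝ) / 5),
        if kb.2 then (1 / 2 : ℝ) else -(1 / 2)] : EuclideanSpace ℝ (Fin 3))) := by
    rintro p (rfl | rfl | ⟨k, σ, hσ, rfl⟩)
    · exact Or.inl (Or.inl rfl)
    · exact Or.inl (Or.inr rfl)
    · rcases hσ with rfl | rfl
      · exact Or.inr ⟨(k, true), by simp⟩
      · exact Or.inr ⟨(k, false), by simp⟩
  have hfin : D.Finite := ((Set.toFinite _).union (Set.finite_range _)).subset hsub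
  refine ⟨hfin.toFinset, hfin.coe_toFinset, fun v hv => ?_, ⟨!₂[(0 : ℝ), 0, 1], ?_⟩⟩
  · rw [Set.Finite.mem_toFinset] at hv
    rcases hv with rfl | rfl | ⟨k, σ, hσ, rfl⟩
    · exact norm_pole_eq_one 1 (Or.inl rfl)
    · exact norm_pole_eq_one (-1) (Or.inr rfl)
    · exact norm_ring_eq_one _ σ hσ
  · rw [Set.Finite.mem_toFinset]
    exact Or.inl rfl

/-! ## The route's alphabet predicate versus `PatternGood` (third pattern as a set `D = ↑P`) -/

/-- **Bridge, forward.** Alphabet-goodness (fcc, hcp, or a third pattern given as a set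
`D = ↑P`) together with a bound `R₀` on the local scale gives `PatternGood` for fcc, hcp or `P`
with scale bound `R₀` (pure repackaging: the `let d` / `let T` clauses agree). [folklore] -/
theorem agce_good3_of_alphabet (P : Finset (EuclideanSpace ℝ (Fin 3)))
    (D : Set (EuclideanSpace ℝ (Fin 3))) (hPD : (↑P : Set (EuclideanSpace ℝ (Fin 3))) = D)
    {R₀ : ℝ} {S : Set (EuclideanSpace ℝ (Fin 3))} {y : EuclideanSpace ℝ (Fin 3)}
    (h : let d : ℝ := sInf ((fun z => dist z y) '' (S \ {y})); let T : Set (EuclideanSpace ℝ (Fin 3)) := {z : EuclideanSpace ℝ (Fin 3) | z ∈ S ∧ z ≠ y ∧ dist z y < 13 / 10 * d}; ∃ A : EuclideanSpace ℝ (Fin 3) →ₗᵢ[ℝ] EuclideanSpace ℝ (Fin 3), (∃ e : ↥T ≃ ↥Literature.Geometry.DiscreteGeometry.fccKissingPattern, ∀ t : ↥T, dist (d⁻¹ • ((t : EuclideanSpace ℝ (Fin 3)) - y)) (A ((e t : ↥Literature.Geometry.DiscreteGeometry.fccKissingPattern) : EuclideanSpace ℝ (Fin 3))) ≤ 1 /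 20) ∨ (∃ e : ↥T ≃ ↥Literature.Geometry.DiscreteGeometry.hcpKissingPattern, ∀ t : ↥T, dist (d⁻¹ • ((t : EuclideanSpace ℝ (Fin 3)) - y)) (A ((e t : ↥Literature.Geometry.DiscreteGeometry.hcpKissingPattern) : EuclideanSpace ℝ (Fin 3))) ≤ 1 / 20) ∨ (∃ e : ↥T ≃ ↥D, ∀ t : ↥T, dist (d⁻¹ • ((t : EuclideanSpace ℝ (Fin 3)) - y)) (A ((e t : ↥D) : EuclideanSpace ℝ (Fin 3))) ≤ 1 / 20))
    (hd : sInf ((fun z => dist z y) '' (S \ {y})) ≤ R₀) :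
    PatternGood fccKissingPattern R₀ S y ∨ PatternGood hcpKissingPattern R₀ S y ∨
      PatternGood P R₀ S y := by
  subst hPD
  simp only [PatternGood]
  obtain ⟨A, h | h | ⟨e, he⟩⟩ := h
  · exact Or.inl ⟨hd, A, h⟩
  · exact Or.inr (Or.inl ⟨hd, A, h⟩)
  · exact Or.inr (Or.inr ⟨hd, A, e, he⟩)

/-- **Bridge, backward.** `PatternGood` for fcc, hcp or `P` (scale bound `R₀`) gives
alphabet-goodness (third pattern as the set `D = ↑P`) and the scale bound. [folklore] -/
theorem agce_alphabet_of_good3 (P : Finset (EuclideanSpace ℝ (Fin 3)))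
    (D : Set (EuclideanSpace ℝ (Fin 3))) (hPD : (↑P : Set (EuclideanSpace ℝ (Fin 3))) = D)
    {R₀ : ℝ} {S : Set (EuclideanSpace ℝ (Fin 3))} {y : EuclideanSpace ℝ (Fin 3)}
    (h : PatternGood fccKissingPattern R₀ S y ∨ PatternGood hcpKissingPattern R₀ S y ∨
      PatternGood P R₀ S y) :
    (let d : ℝ := sInf ((fun z => dist z y) '' (S \ {y})); let T : Set (EuclideanSpace ℝ (Fin 3)) := {z : EuclideanSpace ℝ (Fin 3) | z ∈ S ∧ z ≠ y ∧ dist z y < 13 / 10 * d}; ∃ A : EuclideanSpace ℝ (Fin 3) →ₗᵢ[ℝ] EuclideanSpace ℝ (Fin 3), (∃ e : ↥T ≃ ↥Literature.Geometry.DiscreteGeometry.fccKissingPattern, ∀ t : ↥T, dist (d⁻¹ • ((t : EuclideanSpace ℝ (Fin 3)) - y)) (A ((e t : ↥Literature.Geometry.DiscreteGeometry.fccKissingPattern) : EuclideanSpace ℝ (Fin 3))) ≤ 1 / 20) ∨ (∃ e : ↥T ≃ ↥Literature.Geometry.DiscreteGeometry.hcpKissingPattern, ∀ t : ↥T, dist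 (d⁻¹ • ((t : EuclideanSpace ℝ (Fin 3)) - y)) (A ((e t : ↥Literature.Geometry.DiscreteGeometry.hcpKissingPattern) : EuclideanSpace ℝ (Fin 3))) ≤ 1 / 20) ∨ (∃ e : ↥T ≃ ↥D, ∀ t : ↥T, dist (d⁻¹ • ((t : EuclideanSpace ℝ (Fin 3)) - y)) (A ((e t : ↥D) : EuclideanSpace ℝ (Fin 3))) ≤ 1 / 20)) ∧
      sInf ((fun z => dist z y) '' (S \ {y})) ≤ R₀ := by
  subst hPD
  simp only [PatternGood] at h
  rcases h with ⟨hd, A, e, he⟩ | ⟨hd, A, e, he⟩ | ⟨hd, A, e, he⟩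
  · exact ⟨⟨A, Or.inl ⟨e, he⟩⟩, hd⟩
  · exact ⟨⟨A, Or.inr (Or.inl ⟨e, he⟩)⟩, hd⟩
  · exact ⟨⟨A, Or.inr (Or.inr ⟨e, he⟩)⟩, hd⟩

/-- **An alphabet-good site has a nonempty shell**: if the third pattern `D = ↑P` is non-empty
(fcc and hcp are), an alphabet-good `y` has another point of `S`. [folklore] -/
theorem agce_exists_other_of_alphabet (P : Finset (EuclideanSpace ℝ (Fin 3)))
    (D : Set (EuclideanSpace ℝ (Fin 3))) (hPD : (↑P : Set (EuclideanSpace ℝ (Fin 3))) = D)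
    (hPne : P.Nonempty) {S : Set (EuclideanSpace ℝ (Fin 3))} {y : EuclideanSpace ℝ (Fin 3)}
    (h : let d : ℝ := sInf ((fun z => dist z y) '' (S \ {y})); let T : Set (EuclideanSpace ℝ (Fin 3)) := {z : EuclideanSpace ℝ (Fin 3) | z ∈ S ∧ z ≠ y ∧ dist z y < 13 / 10 * d}; ∃ A : EuclideanSpace ℝ (Fin 3) →ₗᵢ[ℝ] EuclideanSpace ℝ (Fin 3), (∃ e : ↥T ≃ ↥Literature.Geometry.DiscreteGeometry.fccKissingPattern, ∀ t : ↥T, dist (d⁻¹ • ((t : EuclideanSpace ℝ (Fin 3)) - y)) (A ((e t : ↥Literature.Geometry.DiscreteGeometry.fccKissingPattern) : EuclideanSpace ℝ (Fin 3))) ≤ 1 / 20) ∨ (∃ e : ↥T ≃ ↥Literature.Geometry.DiscreteGeometry.hcpKissingPattern, ∀ t : ↥T, dist (d⁻¹ • ((t : EuclideanSpace ℝ (Fin 3)) - y)) (A ((e t : ↥Literature.Geometry.DiscreteGeometry.hcpKissingPattern) : EuclideanSpace ℝ (Fin 3))) ≤ 1 / 20) ∨ (∃ e : ↥T ≃ ↥D,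 ∀ t : ↥T, dist (d⁻¹ • ((t : EuclideanSpace ℝ (Fin 3)) - y)) (A ((e t : ↥D) : EuclideanSpace ℝ (Fin 3))) ≤ 1 / 20)) :
    ∃ z ∈ S, z ≠ y := by
  subst hPD
  obtain ⟨⟨-, v₁, hv₁⟩, ⟨-, v₂, hv₂⟩⟩ := hge_patterns_unit_nonempty
  obtain ⟨v₃, hv₃⟩ := hPne
  obtain ⟨-, ⟨e, -⟩ | ⟨e, -⟩ | ⟨e, -⟩⟩ := h
  · exact ⟨_, (e.symm ⟨v₁, hv₁⟩).2.1, (e.symm ⟨v₁, hv₁⟩).2.2.1⟩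
  · exact ⟨_, (e.symm ⟨v₂, hv₂⟩).2.1, (e.symm ⟨v₂, hv₂⟩).2.2.1⟩
  · exact ⟨_, (e.symm ⟨v₃, Finset.mem_coe.2 hv₃⟩).2.1, (e.symm ⟨v₃, Finset.mem_coe.2 hv₃⟩).2.2.1⟩

/-! ## The generic exactification -/


/-- Eventually `A ∧ (B ∨ C ∨ D)` gives frequently `A ∧ B`, frequently `A ∧ C` or frequently
`A ∧ D`. [folklore] -/
theorem agce_frequently_or₃ {A B C D : ℕ → Prop} (h : ∀ᶠ k in atTop, A k ∧ (B k ∨ C k ∨ D k)) :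
    (∃ᶠ k in atTop, A k ∧ B k) ∨ (∃ᶠ k in atTop, A k ∧ C k) ∨ (∃ᶠ k in atTop, A k ∧ D k) := by
  by_contra hcon
  rw [not_or, not_or, Filter.not_frequently, Filter.not_frequently, Filter.not_frequently] at hcon
  obtain ⟨k, hk, hk1, hk2, hk3⟩ := (h.and (hcon.1.and (hcon.2.1.and hcon.2.2))).exists
  rcases hk.2 with hb | hc | hd
  · exact hk1 ⟨hk.1, hb⟩
  · exact hk2 ⟨hk.1, hc⟩
  · exact hk3 ⟨hk.1, hd⟩

/-- **Per-particle goodness, three patterns.** Let `G` be a goodness predicate such that a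
`G`-good site has another point of the set, and is `PatternGood` for fcc, hcp or `P` as soon as
its local scale is `≤ R₀`.  Then a `G`-good particle of an injective, `δ`-separated, `R₀`-bonded
configuration is `PatternGood` (fcc, hcp or `P`) with scale `≤ R₀`, also after translating the
configuration. [folklore] -/
theorem agce_good3_particle {P : Finset (EuclideanSpace ℝ (Fin 3))} (hP1 : ∀ v ∈ P, ‖v‖ = 1)
    (hPne : P.Nonempty)
    {G : Set (EuclideanSpace ℝ (Fin 3)) → EuclideanSpace ℝ (Fin 3) → Prop}
    (hGne : ∀ S y, G S y → ∃ z ∈ S, z ≠ y)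
    (hG3 : ∀ S y (R₀ : ℝ), G S y → sInf ((fun z => dist z y) '' (S \ {y})) ≤ R₀ →
      PatternGood fccKissingPattern R₀ S y ∨ PatternGood hcpKissingPattern R₀ S y ∨
        PatternGood P R₀ S y)
    {N : ℕ} {x : Fin N → EuclideanSpace ℝ (Fin 3)} {δ R₀ : ℝ}
    (hδ : 0 < δ) (hinj : Function.Injective x) (hsep : ∀ i j, i ≠ j → δ ≤ dist (x i) (x j))
    (hbond : ∀ i j : Fin N, j ≠ i → ∃ k : Fin N, k ≠ i ∧ dist (x i) (x k) ≤ R₀) {j : Fin N}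
    (hg : G (Set.range x) (x j)) (c : EuclideanSpace ℝ (Fin 3)) :
    PatternGood fccKissingPattern R₀ (Set.range fun i => x i + c) (x j + c) ∨
      PatternGood hcpKissingPattern R₀ (Set.range fun i => x i + c) (x j + c) ∨
      PatternGood P R₀ (Set.range fun i => x i + c) (x j + c) := by
  have hsepS : ∀ p ∈ Set.range x, ∀ q ∈ Set.range x, p ≠ q → δ ≤ dist p q := by
    rintro _ ⟨i, rfl⟩ _ ⟨i', rfl⟩ hne
    exact hsep i i' fun h => hne (h ▸ rfl)
  have hyS : x j ∈ Set.range x := Set.mem_range_self j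
  obtain ⟨⟨hf1, hfne⟩, ⟨hh1, hhne⟩⟩ := hge_patterns_unit_nonempty
  -- a good particle has another particle, hence a neighbour within the bond radius
  obtain ⟨z, ⟨j', rfl⟩, hj'⟩ := hGne _ _ hg
  obtain ⟨k, hkj, hk⟩ := hbond j j' fun h => hj' (by rw [h])
  have hd : sInf ((fun z => dist z (x j)) '' (Set.range x \ {x j})) ≤ R₀ :=
    (hge_sInf_le_dist (Set.mem_range_self k) fun h => hkj (hinj h)).trans (by rwa [dist_comm])
  have hPG := hG3 _ _ R₀ hg hd
  rw [hge_range_add_const]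
  rcases hPG with h | h | h
  · exact Or.inl (h.translate hδ hf1 hfne hsepS hyS c)
  · exact Or.inr (Or.inl (h.translate hδ hh1 hhne hsepS hyS c))
  · exact Or.inr (Or.inr (h.translate hδ hP1 hPne hsepS hyS c))

/-- **Clean hull element with bounded scale, generic third pattern.** Let `P` be a non-empty
pattern of unit vectors and `G` a goodness predicate as in `agce_good3_particle`.  If the
fraction of `G`-bad particles of a sequence of Lennard-Jones ground states tends to `0`, some
local limit `S ∋ 0` of translates along a subsequence is `δ`-separated and every `y ∈ S` is
`PatternGood` for fcc, hcp or `P` with scale `≤ R₀` (pattern of `hullGoodEverywhere_proof`: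
clean centres by pigeonhole, diagonal radii, recentring, compactness, goodness to the limit
pattern by pattern). [folklore] -/
theorem agce_clean_generic {P : Finset (EuclideanSpace ℝ (Fin 3))} (hP1 : ∀ v ∈ P, ‖v‖ = 1)
    (hPne : P.Nonempty)
    (G : Set (EuclideanSpace ℝ (Fin 3)) → EuclideanSpace ℝ (Fin 3) → Prop)
    (hGne : ∀ S y, G S y → ∃ z ∈ S, z ≠ y)
    (hG3 : ∀ S y (R₀ : ℝ), G S y → sInf ((fun z => dist z y) '' (S \ {y})) ≤ R₀ →
      PatternGood fccKissingPattern R₀ S y ∨ PatternGood hcpKissingPattern R₀ S y ∨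
        PatternGood P R₀ S y)
    (x : (N : ℕ) → (Fin N → EuclideanSpace ℝ (Fin 3)))
    (hx : ∀ N, IsGroundState lennardJones (x N))
    (hbad : Tendsto (fun N : ℕ =>
      (Nat.card {i : Fin N // ¬ G (Set.range (x N)) (x N i)} : ℝ) / (N : ℝ)) atTop (𝓝 (0 : ℝ))) :
    ∃ S : Set (EuclideanSpace ℝ (Fin 3)), ∃ δ R₀ : ℝ, 0 < δ ∧
      (∀ y ∈ S, ∀ z ∈ S, y ≠ z → δ ≤ dist y z) ∧ (0 : EuclideanSpace ℝ (Fin 3)) ∈ S ∧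
      (∃ φ : ℕ → ℕ, StrictMono φ ∧ ∃ τ : ℕ → EuclideanSpace ℝ (Fin 3), ∀ R ε : ℝ, 0 < ε →
        ∀ᶠ j : ℕ in atTop,
          (∀ s ∈ S, ‖s‖ ≤ R → ∃ i : Fin (φ j), dist (x (φ j) i + τ j) s ≤ ε) ∧
          (∀ i : Fin (φ j), ‖x (φ j) i + τ j‖ ≤ R → ∃ s ∈ S, dist (x (φ j) i + τ j) s ≤ ε)) ∧
      (∀ y ∈ S, PatternGood fccKissingPattern R₀ S y ∨ PatternGood hcpKissingPattern R₀ S y ∨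
        PatternGood P R₀ S y) := by
  classical
  obtain ⟨δ, hδ, hsepall⟩ := LennardJonesMinimalDistance_holds
  obtain ⟨R₀, -, hbond⟩ := hge_exists_bond_radius
  -- Step 1: clean centres of every radius `k`, eventually in `N`
  have hclean : ∀ k : ℕ, ∀ᶠ N in atTop, ∃ i : Fin N, ∀ j : Fin N,
      dist (x N j) (x N i) ≤ k → G (Set.range (x N)) (x N j) := by
    intro k
    set M : ℝ := (2 * (k : ℝ) / δ + 1) ^ 3 with hM
    have ht := hbad.const_mul M
    rw [mul_zero] at ht
    filter_upwards [ht.eventually_lt_const zero_lt_one, eventually_gt_atTop 0] with N hN1 hN0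
    have hNpos : (0 : ℝ) < N := by exact_mod_cast hN0
    set D : Finset (Fin N) := Finset.univ.filter fun i => ¬ G (Set.range (x N)) (x N i) with hD
    have hcardD : (D.card : ℝ) = Nat.card {i : Fin N // ¬ G (Set.range (x N)) (x N i)} := by
      rw [Nat.card_eq_fintype_card, Fintype.card_subtype]
    have hlt : (D.card : ℝ) * (2 * (k : ℝ) / δ + 1) ^ 3 < N := by
      rw [hcardD, ← hM]
      rw [← mul_div_assoc, mul_comm] at hN1
      rwa [div_lt_iff₀ hNpos, one_mul] at hN1
    obtain ⟨i, hi⟩ := hb_exists_far_from (x N) hδ (Nat.cast_nonneg k) (hsepall N (x N) (hx N)) D hlt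
    refine ⟨i, fun j hj => ?_⟩
    by_contra hbadj
    exact hi j hj (Finset.mem_filter.2 ⟨Finset.mem_univ _, hbadj⟩)
  -- Step 2: diagonal choice of radii and recentring
  obtain ⟨φ₀, hφ₀, hcen⟩ := extraction_forall_of_eventually hclean
  choose ic hic using hcen
  set c : ℕ → EuclideanSpace ℝ (Fin 3) := fun k => -x (φ₀ k) (ic k) with hc
  set Y : ℕ → Set (EuclideanSpace ℝ (Fin 3)) := fun k => Set.range fun j => x (φ₀ k) j + c k
    with hY
  have hYsep : ∀ k, ∀ p ∈ Y k, ∀ q ∈ Y k, p ≠ q → δ ≤ dist p q := by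
    intro k
    rintro _ ⟨j, rfl⟩ _ ⟨j', rfl⟩ hne
    rw [dist_add_right]
    exact hsepall _ _ (hx _) j j' fun h => hne (by simp [h])
  -- Step 3: compactness
  obtain ⟨φ₁, S, hφ₁, hSsep, hlim⟩ := exists_subseq_forall_eventually_ballMatch hδ Y hYsep
  have hYsepφ : ∀ k, ∀ p ∈ Y (φ₁ k), ∀ q ∈ Y (φ₁ k), p ≠ q → δ ≤ dist p q := fun k => hYsep (φ₁ k)
  -- `0 ∈ S`
  have h0Y : ∀ k, (0 : EuclideanSpace ℝ (Fin 3)) ∈ Y k := fun k => ⟨ic k, by simp [hc]⟩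
  have h0S : (0 : EuclideanSpace ℝ (Fin 3)) ∈ S :=
    hge_mem_of_tendsto hδ hSsep hlim (Eventually.of_forall fun k => h0Y (φ₁ k)) tendsto_const_nhds
  -- Step 4: every point of `S` is good with scale `≤ R₀`
  have hgoodS : ∀ y ∈ S, PatternGood fccKissingPattern R₀ S y ∨
      PatternGood hcpKissingPattern R₀ S y ∨ PatternGood P R₀ S y := by
    intro y hyS
    obtain ⟨hpY, hpy⟩ := hge_exists_approx hδ hYsepφ hlim hyS
    set p : ℕ → EuclideanSpace ℝ (Fin 3) := fun k => nearPt (Y (φ₁ k)) y with hp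
    -- eventually `p k` is a good particle of the recentred configuration
    have hnorm : ∀ᶠ k in atTop, ‖p k‖ < ‖y‖ + 1 := by
      filter_upwards [Metric.tendsto_nhds.1 hpy 1 one_pos] with k hk
      have := norm_le_norm_add_norm_sub' (p k) y
      rw [← dist_eq_norm] at this
      linarith
    have hk1 : ∀ᶠ k : ℕ in atTop, ‖y‖ + 1 ≤ (k : ℝ) :=
      tendsto_natCast_atTop_atTop.eventually_ge_atTop _
    have hev : ∀ᶠ k in atTop, p k ∈ Y (φ₁ k) ∧
        (PatternGood fccKissingPattern R₀ (Y (φ₁ k)) (p k) ∨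
          PatternGood hcpKissingPattern R₀ (Y (φ₁ k)) (p k) ∨
          PatternGood P R₀ (Y (φ₁ k)) (p k)) := by
      filter_upwards [hpY, hnorm, hk1] with k hk hkn hk1
      refine ⟨hk, ?_⟩
      obtain ⟨j, hj⟩ := hk
      have hj' : x (φ₀ (φ₁ k)) j + c (φ₁ k) = p k := hj
      have hdist : dist (x (φ₀ (φ₁ k)) j) (x (φ₀ (φ₁ k)) (ic (φ₁ k))) ≤ (φ₁ k : ℕ) := by
        have e : dist (x (φ₀ (φ₁ k)) j) (x (φ₀ (φ₁ k)) (ic (φ₁ k))) = ‖p k‖ := by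
          rw [← hj', dist_eq_norm]
          simp only [hc, sub_eq_add_neg]
        rw [e]
        have hkk : (k : ℝ) ≤ (φ₁ k : ℕ) := by exact_mod_cast hφ₁.id_le k
        linarith
      have hgood := hic (φ₁ k) j hdist
      have := agce_good3_particle hP1 hPne hGne hG3 hδ (hx _).1 (hsepall _ _ (hx _))
        (hbond _ _ (hx _)) hgood (c (φ₁ k))
      rw [hj'] at this
      exact this
    -- one pattern frequently; extract and pass to the limit
    obtain ⟨⟨hf1, hfne⟩, ⟨hh1, hhne⟩⟩ := hge_patterns_unit_nonempty
    rcases agce_frequently_or₃ hev with hfr | hfr | hfr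
    · obtain ⟨ψ, hψ, hψP⟩ := extraction_of_frequently_atTop hfr
      exact Or.inl (hge_patternGood_of_limit hf1 hfne hδ (fun k => hYsepφ (ψ k)) hSsep
        (fun R ε hε => hψ.tendsto_atTop.eventually (hlim R ε hε)) (fun k => (hψP k).1)
        (hpy.comp hψ.tendsto_atTop) (fun k => (hψP k).2))
    · obtain ⟨ψ, hψ, hψP⟩ := extraction_of_frequently_atTop hfr
      exact Or.inr (Or.inl (hge_patternGood_of_limit hh1 hhne hδ (fun k => hYsepφ (ψ k)) hSsep
        (fun R ε hε => hψ.tendsto_atTop.eventually (hlim R ε hε)) (fun k => (hψP k).1)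
        (hpy.comp hψ.tendsto_atTop) (fun k => (hψP k).2)))
    · obtain ⟨ψ, hψ, hψP⟩ := extraction_of_frequently_atTop hfr
      exact Or.inr (Or.inr (hge_patternGood_of_limit hP1 hPne hδ (fun k => hYsepφ (ψ k)) hSsep
        (fun R ε hε => hψ.tendsto_atTop.eventually (hlim R ε hε)) (fun k => (hψP k).1)
        (hpy.comp hψ.tendsto_atTop) (fun k => (hψP k).2)))
  -- Step 5: assemble
  refine ⟨S, δ, R₀, hδ, hSsep, h0S, ⟨fun j => φ₀ (φ₁ j), hφ₀.comp hφ₁, fun j => c (φ₁ j), ?_⟩,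
    hgoodS⟩
  intro R ε hε
  filter_upwards [hlim R ε hε] with j hj
  exact (ballMatch_zero_range_iff (fun i => x (φ₀ (φ₁ j)) i + c (φ₁ j)) ε R).1 hj

/-! ## The stub -/

/-- **STUB 2 of line `birth` — clean hull element with bounded scale** (exactification no. 1 of
`HullExactificationCascade` re-run with the enlarged alphabet {fcc, hcp, decahedral axis}).  If
the alphabet-defect fraction of a sequence of Lennard-Jones ground states tends to `0`, some hull
element `S` of it (two-way matching of translates along a subsequence on every ball) is
`δ`-separated, contains `0`, and every `y ∈ S` is alphabet-good with local scale
`sInf (dist · y '' (S ∖ {y})) ≤ R₀`: `agce_clean_generic` with the decahedral-axis `Finset` of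
`agce_exists_decFinset` and the bridges `agce_good3_of_alphabet` / `agce_alphabet_of_good3`.
[folklore] -/
theorem stub_alphabetCleanHullElement : let GA : Set (EuclideanSpace ℝ (Fin 3)) → EuclideanSpace ℝ (Fin 3) → Prop := fun S y => let d : ℝ := sInf ((fun z => dist z y) '' (S \ {y})); let T : Set (EuclideanSpace ℝ (Fin 3)) := {z : EuclideanSpace ℝ (Fin 3) | z ∈ S ∧ z ≠ y ∧ dist z y < 13 / 10 * d}; ∃ A : EuclideanSpace ℝ (Fin 3) →ₗᵢ[ℝ] EuclideanSpace ℝ (Fin 3), (∃ e : ↥T ≃ ↥Literature.Geometry.DiscreteGeometry.fccKissingPattern, ∀ t : ↥T, dist (d⁻¹ • ((t : EuclideanSpace ℝ (Fin 3)) - y)) (A ((e t : ↥Literature.Geometry.DiscreteGeometry.fccKissingPattern) : EuclideanSpace ℝ (Fin 3))) ≤ 1 / 20) ∨ (∃ e : ↥T ≃ ↥Literature.Geometry.DiscreteGeometry.hcpKissingPattern, ∀ t : ↥T, dist (d⁻¹ • ((t : EuclideanSpace ℝ (Fin 3)) - y)) (A ((e t : ↥Literature.Geometry.DiscreteGeometry.hcpKissingPattern)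 : EuclideanSpace ℝ (Fin 3))) ≤ 1 / 20) ∨ (∃ e : ↥T ≃ ↥{p : EuclideanSpace ℝ (Fin 3) | p = !₂[(0 : ℝ), 0, 1] ∨ p = !₂[(0 : ℝ), 0, -1] ∨ ∃ k : Fin 5, ∃ σ : ℝ, (σ = 1 / 2 ∨ σ = -(1 / 2)) ∧ p = !₂[Real.sqrt 3 / 2 * Real.cos (2 * Real.pi * (k : ℝ) / 5), Real.sqrt 3 / 2 * Real.sin (2 * Real.pi * (k : ℝ) / 5), σ]}, ∀ t : ↥T, dist (d⁻¹ • ((t : EuclideanSpace ℝ (Fin 3)) - y)) (A ((e t : ↥{p : EuclideanSpace ℝ (Fin 3) | p = !₂[(0 : ℝ), 0, 1] ∨ p = !₂[(0 : ℝ), 0, -1] ∨ ∃ k : Fin 5, ∃ σ : ℝ, (σ = 1 / 2 ∨ σ = -(1 / 2)) ∧ p = !₂[Real.sqrt 3 / 2 * Real.cos (2 * Real.pi * (k : ℝ) / 5), Real.sqrt 3 / 2 * Real.sin (2 * Real.pi * (k : ℝ) / 5), σ]}) : EuclideanSpace ℝ (Fin 3))) ≤ 1 / 20); let HL : ((N :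 ℕ) → (Fin N → EuclideanSpace ℝ (Fin 3))) → Set (EuclideanSpace ℝ (Fin 3)) → Prop := fun x S => ∃ φ : ℕ → ℕ, StrictMono φ ∧ ∃ τ : ℕ → EuclideanSpace ℝ (Fin 3), ∀ R ε : ℝ, 0 < ε → ∀ᶠ j : ℕ in Filter.atTop, (∀ s ∈ S, ‖s‖ ≤ R → ∃ i : Fin (φ j), dist (x (φ j) i + τ j) s ≤ ε) ∧ (∀ i : Fin (φ j), ‖x (φ j) i + τ j‖ ≤ R → ∃ s ∈ S, dist (x (φ j) i + τ j) s ≤ ε); ∀ (x : (N : ℕ) → (Fin N → EuclideanSpace ℝ (Fin 3))), (∀ N, Literature.MathematicalPhysics.StatisticalMechanics.IsGroundState Literature.MathematicalPhysics.StatisticalMechanics.lennardJones (x N)) → Filter.Tendsto (fun N : ℕ => (Nat.card {i : Fin N // ¬ GA (Set.range (x N)) (x N i)} : ℝ) / (N : ℝ)) Filter.atTop (nhds (0 : ℝ)) → ∃ S : Set (EuclideanSpace ℝ (Fin 3)), ∃ δ R₀ : ℝ, 0 < δ ∧ (∀ y ∈ S, ∀ z ∈ S, y ≠ z → δ ≤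 dist y z) ∧ (0 : EuclideanSpace ℝ (Fin 3)) ∈ S ∧ HL x S ∧ (∀ y ∈ S, GA S y ∧ sInf ((fun z => dist z y) '' (S \ {y})) ≤ R₀) := by
  intro GA HL x hx hbad
  obtain ⟨P, hPD, hP1, hPne⟩ := agce_exists_decFinset
  obtain ⟨S, δ, R₀, hδ, hsep, h0, hHL, hgood⟩ := agce_clean_generic hP1 hPne GA
    (fun S y hg => agce_exists_other_of_alphabet P _ hPD hPne hg)
    (fun S y R₀ hg hd => agce_good3_of_alphabet P _ hPD hg hd) x hx hbad
  exact ⟨S, δ, R₀, hδ, hsep, h0, hHL, fun y hy => agce_alphabet_of_good3 P _ hPD (hgood y hy)⟩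

end Summit.AtomisticToContinuum.Crystallization.Theorems.AlphabetGoodHullElementBirth

end
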